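import Summits.NavierStokesRegularity.NavierStokesRegularity.Theorems.LerayQuarterDissipationRecurrentReductionD
import Summits.NavierStokesRegularity.NavierStokesRegularity.Theorems.LerayQuarterDissipationFiniteDissipationLiouvilleStubSmallDissipationGap
import Summits.NavierStokesRegularity.NavierStokesRegularity.Theorems.SqueezeCycleExtremalElementExistsExtraction
import HarnessLib

/-!
# Crux `FiniteDissipationLiouville` (stmt-NavierStokesRegularity-22144): the SUB-THRESHOLD leaf —
# a finite-dissipation Type-I profile whose dimensionless dissipation stays below the gap constant
# on log-time windows of unbounded length is regular at the apex

Theorems file of route `LerayQuarterDissipation` (seat ns-lqd-p1 g2; `--supports` the crux and its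
child `RecurrentDissipativeLiouville`, stmt-22508). Navier–Stokes regularity is NOT proved by
anything here; no summit is.

The stratum `𝒟`: Type-I ancient mild fields `u` in the KNSS gauge (`IsTypeIAncientMild C u`) with
the quarter-rate dissipation law `∫ ‖∇u(s)‖² ≤ K/√(−s)`, `s < 0`. Write
`D_u(t) := √(−t) ∫ ‖∇u(t)‖²` for the DIMENSIONLESS (scale-invariant) dissipation, so that the law reads
`D_u ≤ K`, and `D_{u_l}(s) = D_u(l² s)` along the scaling orbit `u_l(s,y) = l u(l²s, l y)`.
The line's BC5 rung (`…Birth.stub_smallDissipationGap`, p579719) gives an absolute `K₀ > 0` with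
`D_u ≤ K₀ everywhere ⇒ u ≡ 0`. This file upgrades "everywhere" to "on arbitrarily long log-time
windows, anywhere in the past":

* `lintegral_fderiv_sq_le_of_tendsto_of_eventually` — Fatou along pointwise gradient convergence
  with bounds holding only EVENTUALLY (variant of p1 g0's `dissipationLaw_of_tendsto_fderiv`);
* `exists_orbitLimit_of_eventually_law` — along any scales `l_k > 0` at which the rescaled laws
  `D_{u_{l_k}}(s) ≤ K₁` hold eventually for every fixed `s < 0`, a subsequence of `u_{l_k}` converges
  (uniformly on the slab pieces, pointwise with gradients) to a member `W` of the class whose law has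
  the SMALLER constant `K₁` (KNSS compactness `orbitLimit` / `exists_tendsto_of_isTypeIAncientMild_seq`
  + Fatou);
* `notSingular_of_subthreshold_along_scales` — **the leaf**: there is an absolute `K₀ > 0` (the gap
  constant) such that every member of `𝒟` admitting scales `l_k > 0` with
  `D_u(l_k² s) ≤ K₁ ≤ K₀` eventually in `k`, for every fixed `s < 0`, is bounded on some backward
  cylinder at the origin: the orbit limit `W` has `D_W ≤ K₁ ≤ K₀`, so `W ≡ 0` by the gap, while a
  singular `u` would force `W` singular by the PERSISTENCE of the apex singularity along the orbit
  (p1 g0's `RecurrentReductionD.persistent_singularity`, the heart of the proved child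
  `RecurrentReductionD`);
* `notSingular_of_subthreshold_windows` — window form: if for every `Λ > 1` some backward window
  `[Λ²τ, τ/Λ²]` (`τ < 0`, log-length `4 log Λ`, ANY position) carries `D_u ≤ K₁ ≤ K₀`, then `u` is
  bounded at the apex;
* `dissipation_exceeds_on_every_long_window_of_singular` — contrapositive, the quotable reading:
  **the dimensionless dissipation of a SINGULAR member of the stratum exceeds the gap constant
  somewhere in every sufficiently long log-time window** (there is `Λ > 1` such that every window
  `[Λ²τ, τ/Λ²]`, `τ < 0`, contains a time `t` with `D_u(t) > K₁`), for every `K₁ ≤ K₀` — verbatim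
  applicable to the uniformly recurrent members of child stmt-22508, whose extra hypothesis is not
  used.

References: Koch–Nadirashvili–Seregin–Šverák, Acta Math. 203 (2009) = arXiv:0709.3599, §4, §6;
Albritton–Barker, arXiv:1811.00502, Prop. 2.3 (persistence of singularities).
-/

noncomputable section

-- the summit and its single sub-problem share the name (CONVENTIONS §1), as in every Theorems file
set_option linter.dupNamespace false

namespace Summit.NavierStokesRegularity.NavierStokesRegularity.Theorems.FiniteDissipationLiouville.Subthreshold

open MeasureTheory Set Filter Topology Metric Function
open Literature.Analysis Literature.Analysis.FluidPDE
open scoped ENNReal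

/-! ### Fatou with eventual bounds -/

/-- **Fatou along the gradients, eventual bounds.** If the gradients of the slices `w k s` converge
pointwise to the gradient of `W s` and `∫ ‖∇(w k s)‖² ≤ B` for all large `k`, then
`∫ ‖∇(W s)‖² ≤ B`. -/
theorem lintegral_fderiv_sq_le_of_tendsto_of_eventually
    {w : ℕ → EuclideanSpace ℝ (Fin 3) → EuclideanSpace ℝ (Fin 3)}
    {W : EuclideanSpace ℝ (Fin 3) → EuclideanSpace ℝ (Fin 3)} {B : ℝ≥0∞}
    (hconv : ∀ x, Tendsto (fun k => fderiv ℝ (w k) x) atTop (𝓝 (fderiv ℝ W x)))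
    (hlaw : ∀ᶠ k in atTop, ∫⁻ x, ‖fderiv ℝ (w k) x‖ₑ ^ 2 ≤ B) :
    ∫⁻ x, ‖fderiv ℝ W x‖ₑ ^ 2 ≤ B := by
  have hpt : ∀ x, Tendsto (fun k => ‖fderiv ℝ (w k) x‖ₑ ^ 2) atTop (𝓝 (‖fderiv ℝ W x‖ₑ ^ 2)) :=
    fun x => ((ENNReal.continuous_pow 2).tendsto _).comp ((continuous_enorm.tendsto _).comp (hconv x))
  have e : (fun x => ‖fderiv ℝ W x‖ₑ ^ 2) = fun x => liminf (fun k => ‖fderiv ℝ (w k) x‖ₑ ^ 2) atTop :=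
    funext fun x => ((hpt x).liminf_eq).symm
  have hmeas : ∀ k, AEMeasurable (fun x => ‖fderiv ℝ (w k) x‖ₑ ^ 2) volume := fun k =>
    ((measurable_fderiv ℝ (w k)).enorm.pow_const 2).aemeasurable
  calc ∫⁻ x, ‖fderiv ℝ W x‖ₑ ^ 2 = ∫⁻ x, liminf (fun k => ‖fderiv ℝ (w k) x‖ₑ ^ 2) atTop := by rw [e]
    _ ≤ liminf (fun k => ∫⁻ x, ‖fderiv ℝ (w k) x‖ₑ ^ 2) atTop := lintegral_liminf_le' hmeas
    _ ≤ B := liminf_le_of_frequently_le' (hlaw.frequently)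

/-! ### Orbit limits whose law has the window constant -/

/-- **The rescaled law along a scale.** `D_{u_l}(s) = D_u(l²s)`: if `∫ ‖∇u(l²s)‖² ≤ K₁/√(−l²s)`
then `∫ ‖∇u_l(s)‖² ≤ K₁/√(−s)` (`0 < l`, `s < 0`; `∫‖∇u_l(s)‖² = l ∫‖∇u(l²s)‖²`). -/
theorem law_nsRescale_of_law_at {K₁ l s : ℝ} (hl : 0 < l) (hs : s < 0)
    {u : ℝ → EuclideanSpace ℝ (Fin 3) → EuclideanSpace ℝ (Fin 3)}
    (h : ∫⁻ x, ‖fderiv ℝ (u (l ^ 2 * s)) x‖ₑ ^ 2 ≤ ENNReal.ofReal (K₁ / Real.sqrt (-(l ^ 2 * s)))) :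
    ∫⁻ x, ‖fderiv ℝ (nsRescale l u s) x‖ₑ ^ 2 ≤ ENNReal.ofReal (K₁ / Real.sqrt (-s)) := by
  rw [RecurrentReductionD.lintegral_fderiv_nsRescale_sq hl]
  calc ENNReal.ofReal l * ∫⁻ y, ‖fderiv ℝ (u (l ^ 2 * s)) y‖ₑ ^ 2
      ≤ ENNReal.ofReal l * ENNReal.ofReal (K₁ / Real.sqrt (-(l ^ 2 * s))) := by gcongr
    _ = ENNReal.ofReal (K₁ / Real.sqrt (-s)) := by
        rw [← ENNReal.ofReal_mul hl.le]
        congr 1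
        have hs' : 0 < -s := neg_pos.2 hs
        rw [show -(l ^ 2 * s) = l ^ 2 * (-s) by ring, Real.sqrt_mul' _ hs'.le,
          Real.sqrt_sq hl.le]
        field_simp

/-- **Orbit limit with the window constant.** Let `u` be a member of the class (`IsTypeIAncientMild
C u`, law `K`), `l_k > 0` scales such that for every fixed `s < 0` the rescaled law
`∫ ‖∇u_{l_k}(s)‖² ≤ K₁/√(−s)` holds for all large `k`. Then along a subsequence the rescalings
`u_{l_k}` converge — uniformly on every slab piece `[−(n+2), −1/(n+2)] × B̄(0, n+2)` and pointwise on
the open slab — to a member `W` of the class (constant `C`) whose law has constant `K₁`. -/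
theorem exists_orbitLimit_of_eventually_law {C K K₁ : ℝ}
    {u : ℝ → EuclideanSpace ℝ (Fin 3) → EuclideanSpace ℝ (Fin 3)} (hu : IsTypeIAncientMild C u)
    (hlaw : ∀ s : ℝ, s < 0 → ∫⁻ x, ‖fderiv ℝ (u s) x‖ₑ ^ 2 ≤ ENNReal.ofReal (K / Real.sqrt (-s)))
    (l : ℕ → ℝ) (hl : ∀ k, 0 < l k)
    (hwin : ∀ s : ℝ, s < 0 → ∀ᶠ k in atTop,
      ∫⁻ x, ‖fderiv ℝ (nsRescale (l k) u s) x‖ₑ ^ 2 ≤ ENNReal.ofReal (K₁ / Real.sqrt (-s))) :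
    ∃ ψ : ℕ → ℕ, StrictMono ψ ∧
      ∃ W : ℝ → EuclideanSpace ℝ (Fin 3) → EuclideanSpace ℝ (Fin 3),
        IsTypeIAncientMild C W ∧
        (∀ s : ℝ, s < 0 → ∫⁻ x, ‖fderiv ℝ (W s) x‖ₑ ^ 2 ≤ ENNReal.ofReal (K₁ / Real.sqrt (-s))) ∧
        (∀ n : ℕ, TendstoUniformlyOn (fun j z => nsRescale (l (ψ j)) u z.1 z.2) (fun z => W z.1 z.2)
          atTop (Icc (-((n : ℝ) + 2)) (-(1 / ((n : ℝ) + 2))) ×ˢ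
            closedBall (0 : EuclideanSpace ℝ (Fin 3)) ((n : ℝ) + 2))) ∧
        (∀ t < 0, ∀ x, Tendsto (fun j => nsRescale (l (ψ j)) u t x) atTop (𝓝 (W t x))) := by
  -- KNSS compactness along the orbit (p1 g0's `orbitLimit`): uniform convergence on the pieces
  obtain ⟨ψ, hψ, W, hW, -, hunif, hpt⟩ := RecurrentReductionD.orbitLimit hu hlaw l hl
  have hψt : Tendsto ψ atTop atTop := hψ.tendsto_atTop
  -- gradient convergence along a further subsequence (`C¹_loc` compactness of the class)
  set w : ℕ → ℝ → EuclideanSpace ℝ (Fin 3) → EuclideanSpace ℝ (Fin 3) :=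
    fun j => nsRescale (l (ψ j)) u with hw_def
  have hwj : ∀ j, IsTypeIAncientMild C (w j) := fun j => isTypeIAncientMild_nsRescale hu (hl _)
  obtain ⟨φ, hφ, W', -, hpt', hgrad', -, -⟩ := exists_tendsto_of_isTypeIAncientMild_seq C hwj
  have hφt : Tendsto φ atTop atTop := hφ.tendsto_atTop
  -- the two limits agree on the open slab
  have hWW : ∀ t < 0, W' t = W t := by
    intro t ht
    funext x
    exact tendsto_nhds_unique (hpt' t ht x) ((hpt t ht x).comp hφt)
  -- Fatou with the eventual window bounds
  have hlawW : ∀ s : ℝ, s < 0 →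
      ∫⁻ x, ‖fderiv ℝ (W s) x‖ₑ ^ 2 ≤ ENNReal.ofReal (K₁ / Real.sqrt (-s)) := by
    intro s hs
    have hconv : ∀ x, Tendsto (fun j => fderiv ℝ (w (φ j) s) x) atTop (𝓝 (fderiv ℝ (W s) x)) := by
      intro x
      rw [← hWW s hs]
      exact hgrad' s hs x
    refine lintegral_fderiv_sq_le_of_tendsto_of_eventually hconv ?_
    exact (hψt.comp hφt).eventually (hwin s hs)
  exact ⟨ψ, hψ, W, hW, hlawW, hunif, hpt⟩

/-! ### The sub-threshold leaf -/

/-- **Sub-threshold dissipation along a sequence of scales forces apex regularity.** There is an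
absolute `K₀ > 0` (the small-dissipation gap constant of `stub_smallDissipationGap`) such that: if
`u` is a Type-I ancient mild field with the quarter-rate dissipation law (any `C`, `K`) and there
are scales `l_k > 0` with `√(−l_k²s) ∫ ‖∇u(l_k² s)‖² ≤ K₁` for all large `k`, for every fixed
`s < 0`, where `K₁ ≤ K₀`, then `u` is bounded on some backward parabolic cylinder at the origin.
Proof: the orbit limit `W` along `l_k` has law `K₁ ≤ K₀` (`exists_orbitLimit_of_eventually_law`),
hence vanishes by the gap; were `u` singular at the apex, `W` would be singular by persistence
(`RecurrentReductionD.persistent_singularity`) — but `0` is not. -/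
theorem notSingular_of_subthreshold_along_scales :
    ∃ K₀ : ℝ, 0 < K₀ ∧ ∀ (C K K₁ : ℝ)
      (u : ℝ → EuclideanSpace ℝ (Fin 3) → EuclideanSpace ℝ (Fin 3)), K₁ ≤ K₀ →
      IsTypeIAncientMild C u →
      (∀ s : ℝ, s < 0 → ∫⁻ x, ‖fderiv ℝ (u s) x‖ₑ ^ 2 ≤ ENNReal.ofReal (K / Real.sqrt (-s))) →
      (∃ l : ℕ → ℝ, (∀ k, 0 < l k) ∧ ∀ s : ℝ, s < 0 → ∀ᶠ k in atTop,
        ∫⁻ x, ‖fderiv ℝ (u (l k ^ 2 * s)) x‖ₑ ^ 2 ≤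
          ENNReal.ofReal (K₁ / Real.sqrt (-(l k ^ 2 * s)))) →
      ¬ (∀ r > 0, ∀ M : ℝ, ∃ t ∈ Set.Ioo (-(r ^ 2)) (0 : ℝ),
          ∃ x ∈ Metric.ball (0 : EuclideanSpace ℝ (Fin 3)) r, M < ‖u t x‖) := by
  obtain ⟨K₀, hK₀, hgap⟩ := Birth.stub_smallDissipationGap
  refine ⟨K₀, hK₀, fun C K K₁ u hK₁ hu hlaw ⟨l, hl, hwin⟩ hsing => ?_⟩
  -- the rescaled laws along the scales
  have hwin' : ∀ s : ℝ, s < 0 → ∀ᶠ k in atTop,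
      ∫⁻ x, ‖fderiv ℝ (nsRescale (l k) u s) x‖ₑ ^ 2 ≤ ENNReal.ofReal (K₁ / Real.sqrt (-s)) :=
    fun s hs => (hwin s hs).mono fun k hk => law_nsRescale_of_law_at (hl k) hs hk
  -- the orbit limit with the window constant
  obtain ⟨ψ, -, W, hW, hlawW, hunif, -⟩ := exists_orbitLimit_of_eventually_law hu hlaw l hl hwin'
  -- it vanishes by the gap …
  have hz : ∀ t < 0, ∀ x, W t x = 0 := hgap C K₁ W hK₁ hW hlawW
  -- … and is singular by persistence: contradiction
  have hWsing := RecurrentReductionD.persistent_singularity hu hlaw hsing (fun j => l (ψ j))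
    (fun j => hl _) W hunif
  obtain ⟨t, ht, x, -, hM⟩ := hWsing 1 one_pos 0
  rw [hz t ht.2 x, norm_zero] at hM
  exact lt_irrefl 0 hM

/-- **Window form.** There is an absolute `K₀ > 0` such that: if a member of the stratum (any `C`,
`K`) has, for every `Λ > 1`, a backward window `[Λ²τ, τ/Λ²]` (`τ < 0`; log-length `4 log Λ`, at ANY
position in the past) on which `√(−t) ∫ ‖∇u(t)‖² ≤ K₁`, with `K₁ ≤ K₀`, then `u` is bounded on some
backward cylinder at the origin. (Take `Λ_k = k + 2`, scales `l_k = √(−τ_k)`: for fixed `s < 0`,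
`l_k² s = (−τ_k) s` lies in the `k`-th window as soon as `Λ_k² ≥ max(−s, −1/s)`.) -/
theorem notSingular_of_subthreshold_windows :
    ∃ K₀ : ℝ, 0 < K₀ ∧ ∀ (C K K₁ : ℝ)
      (u : ℝ → EuclideanSpace ℝ (Fin 3) → EuclideanSpace ℝ (Fin 3)), K₁ ≤ K₀ →
      IsTypeIAncientMild C u →
      (∀ s : ℝ, s < 0 → ∫⁻ x, ‖fderiv ℝ (u s) x‖ₑ ^ 2 ≤ ENNReal.ofReal (K / Real.sqrt (-s))) →
      (∀ Λ : ℝ, 1 < Λ → ∃ τ : ℝ, τ < 0 ∧ ∀ t ∈ Set.Icc (Λ ^ 2 * τ) (τ / Λ ^ 2),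
        ∫⁻ x, ‖fderiv ℝ (u t) x‖ₑ ^ 2 ≤ ENNReal.ofReal (K₁ / Real.sqrt (-t))) →
      ¬ (∀ r > 0, ∀ M : ℝ, ∃ t ∈ Set.Ioo (-(r ^ 2)) (0 : ℝ),
          ∃ x ∈ Metric.ball (0 : EuclideanSpace ℝ (Fin 3)) r, M < ‖u t x‖) := by
  obtain ⟨K₀, hK₀, h⟩ := notSingular_of_subthreshold_along_scales
  refine ⟨K₀, hK₀, fun C K K₁ u hK₁ hu hlaw hwin => h C K K₁ u hK₁ hu hlaw ?_⟩
  -- windows at `Λ_k = k + 2`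
  have hΛ : ∀ k : ℕ, (1 : ℝ) < (k : ℝ) + 2 := fun k => by
    have : (0 : ℝ) ≤ k := Nat.cast_nonneg k
    linarith
  choose τ hτ hτwin using fun k : ℕ => hwin ((k : ℝ) + 2) (hΛ k)
  refine ⟨fun k => Real.sqrt (-τ k), fun k => Real.sqrt_pos.2 (neg_pos.2 (hτ k)), fun s hs => ?_⟩
  have hl2 : ∀ k, Real.sqrt (-τ k) ^ 2 = -τ k := fun k => Real.sq_sqrt (neg_pos.2 (hτ k)).le
  -- for `k` large, `(k+2)² ≥ -s` and `(k+2)² ≥ -1/s`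
  have hev : ∀ᶠ k : ℕ in atTop, -s ≤ ((k : ℝ) + 2) ^ 2 ∧ -s⁻¹ ≤ ((k : ℝ) + 2) ^ 2 := by
    have hT : Tendsto (fun k : ℕ => ((k : ℝ) + 2) ^ 2) atTop atTop :=
      (tendsto_pow_atTop two_ne_zero).comp
        (tendsto_atTop_add_const_right atTop (2 : ℝ) tendsto_natCast_atTop_atTop)
    exact (hT.eventually_ge_atTop (-s)).and (hT.eventually_ge_atTop (-s⁻¹))
  filter_upwards [hev] with k hk
  obtain ⟨h1, h2⟩ := hk
  rw [hl2 k]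
  refine hτwin k (-τ k * s) ⟨?_, ?_⟩
  · -- `Λ² τ ≤ (-τ) s` iff `-s ≤ Λ²` (as `-τ > 0`)
    have hτ' : 0 < -τ k := neg_pos.2 (hτ k)
    nlinarith
  · -- `(-τ) s ≤ τ / Λ²` iff `1/Λ² ≤ -s`
    have hτ' : 0 < -τ k := neg_pos.2 (hτ k)
    have hΛ2 : (0 : ℝ) < ((k : ℝ) + 2) ^ 2 := by positivity
    rw [le_div_iff₀ hΛ2]
    have hs' : 0 < -s := neg_pos.2 hs
    have h3 : 1 ≤ (-s) * ((k : ℝ) + 2) ^ 2 := by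
      have := mul_le_mul_of_nonneg_left h2 hs'.le
      rwa [show (-s) * (-s⁻¹) = 1 by rw [neg_mul_neg, mul_inv_cancel₀ hs.ne]] at this
    nlinarith

/-- **The dissipation of a singular finite-dissipation profile never sleeps for long** (contrapositive
of `notSingular_of_subthreshold_windows`): there is an absolute `K₀ > 0` such that for every member
`u` of the stratum (any `C`, `K`) which is SINGULAR at the apex and every `K₁ ≤ K₀` there is a
log-window length, `Λ > 1`, such that EVERY backward window `[Λ²τ, τ/Λ²]` (`τ < 0`) contains a time
`t` at which the dimensionless dissipation exceeds `K₁`: `K₁/√(−t) < ∫ ‖∇u(t)‖²`. -/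
theorem dissipation_exceeds_on_every_long_window_of_singular :
    ∃ K₀ : ℝ, 0 < K₀ ∧ ∀ (C K K₁ : ℝ)
      (u : ℝ → EuclideanSpace ℝ (Fin 3) → EuclideanSpace ℝ (Fin 3)), K₁ ≤ K₀ →
      IsTypeIAncientMild C u →
      (∀ s : ℝ, s < 0 → ∫⁻ x, ‖fderiv ℝ (u s) x‖ₑ ^ 2 ≤ ENNReal.ofReal (K / Real.sqrt (-s))) →
      (∀ r > 0, ∀ M : ℝ, ∃ t ∈ Set.Ioo (-(r ^ 2)) (0 : ℝ),
          ∃ x ∈ Metric.ball (0 : EuclideanSpace ℝ (Fin 3)) r, M < ‖u t x‖) →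
      ∃ Λ : ℝ, 1 < Λ ∧ ∀ τ : ℝ, τ < 0 → ∃ t ∈ Set.Icc (Λ ^ 2 * τ) (τ / Λ ^ 2),
        ENNReal.ofReal (K₁ / Real.sqrt (-t)) < ∫⁻ x, ‖fderiv ℝ (u t) x‖ₑ ^ 2 := by
  obtain ⟨K₀, hK₀, h⟩ := notSingular_of_subthreshold_windows
  refine ⟨K₀, hK₀, fun C K K₁ u hK₁ hu hlaw hsing => ?_⟩
  by_contra hcon
  push Not at hcon
  exact h C K K₁ u hK₁ hu hlaw hcon hsing

end Summit.NavierStokesRegularity.NavierStokesRegularity.Theorems.FiniteDissipationLiouville.Subthreshold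

end
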